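import Summits.Langlands.Langlands.Theses.TameTypeSwitch

/-!
# SectorComplement (stmt-Langlands-18277, route TameTypeSwitch) — crux-ideate r1 k2 sketch

Typed record of the ONE seam at which the route's target `X = GappedWeightPA` (single-`r`
POTENTIAL automorphy over a CM Galois `K'/K`, `ℓ` unramified in `K'`) can be consumed
non-idly on the way to `_root_.Langlands`: insoluble descent `K' → K` inside the gapped
Fontaine–Laffaille cell.

* `ActualCellHLTT`  — X with its conclusion moved from `K'` down to `K` (actual automorphy of
  `r` over `K`: a regular algebraic cuspidal `Π` of `GL_n(𝔸_K)`, unramified above `ℓ`,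
  Satake–Frobenius compatible with `r` away from `ℓ`).  This IS an instance of conjunct (B)
  of `_root_.Langlands` (weak form, CM base, regular crystalline gapped `r`), i.e. a genuine
  piece of the summit — unlike X itself, whose conclusion lives over a varying `K'`.
* `InsolubleDescentCell` — the descent seam D: X's binders and cell hypotheses on `r/K`, plus
  "for EVERY finite `Kav/K` there is a potential-automorphy field `K'` as in X" ⇒ actual
  automorphy over `K`.  No solvability of `Gal(K'/K)` is available (Moret-Bailly), so this is
  exactly the statement `Literature.Barriers.Langlands.SolvableImageBarrier` (b) says no
  cyclic-layer base change reaches; it is OPEN for every `n ≥ 2` (Taylor 2006 descends only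
  through soluble co-layers `K'/K'_i` and gets meromorphy, not automorphy, over `K`).
* `actualCell_of_X_D : GappedWeightPA → InsolubleDescentCell → ActualCellHLTT` — pure logic.

This file files NO idea card: D is summit-hard off the shelf and every completion of
`ActualCellHLTT → _root_.Langlands` consists of summit-minus-cell pieces (triage criterion (iv)).
It exists so that a strategist / tenure planner who wants X load-bearing in `closes` has the
seam already typed (line shape: D ∧ B_off-cell ∧ LGC ∧ 𝓡-packaging), and so that the tribunal
can see concretely why `SectorComplement` should be declared `residual`.
-/

set_option linter.dupNamespace false

namespace Summit.Langlands.Langlands.Cruxes.SectorComplement.DescentSeamTTS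

open scoped BigOperators Topology Manifold Classical MeasureTheory ProbabilityTheory Matrix InnerProductSpace ComplexConjugate ContinuousMap
open Filter Set Function TopologicalSpace MeasureTheory
open Summit.Langlands.Langlands.Theses.TameTypeSwitch

/-- X's cell hypotheses on `r/K` (gapped, `ℓ`-unramified Fontaine–Laffaille, residual bigness)
with the conclusion ACTUAL automorphy over `K` (no `Kav`, no `K'`). An instance of conjunct (B)
of the summit restricted to the route's cell. -/
def ActualCellHLTT : Prop :=
  ∀ (K : Type) [Field K] [NumberField K], NumberField.IsCMField K → ∀ (n B : ℕ), 2 ≤ n → ∀ (ℓ : ℕ) [Fact ℓ.Prime], n ^ 2 < ℓ → 2 * B + 2 < ℓ → Algebra.IsUnramifiedIn (NumberField.RingOfIntegers K) (Ideal.span {(ℓ : ℤ)}) → let k := Literature.NumberTheory.GaloisRepresentations.padicAlgClResidueField ℓ; ∀ (ι : PadicAlgCl ℓ ≃+* ℂ) (r : Literature.NumberTheory.GaloisRepresentations.FramedGaloisRep K (PadicAlgCl ℓ) n) (τ : Field.absoluteGaloisGroup K →* GL (Fin n) k), (∀ᶠ v in cofinite, r.IsUnramifiedAt v) → (∀ (v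 : IsDedekindDomain.HeightOneSpectrum (NumberField.RingOfIntegers K)) (hv : (ℓ : NumberField.RingOfIntegers K) ∈ v.asIdeal), let D := Literature.NumberTheory.PAdicHodge.fontainePstAdicCompletion v ℓ hv; D.IsCrystallineFramed (r.toLocal v) ∧ (letI := D.algebra; ∀ τ' : v.adicCompletion K →ₐ[ℚ_[ℓ]] PadicAlgCl ℓ, (r.labelledHodgeTateWeightsAt v D.algebra D.𝔅 τ'.toRingHom).Nodup ∧ ∀ h ∈ r.labelledHodgeTateWeightsAt v D.algebra D.𝔅 τ'.toRingHom, 0 ≤ h ∧ h ≤ (B : ℤ))) → (∃ (v : IsDedekindDomain.HeightOneSpectrum (NumberField.RingOfIntegers K)) (hv : (ℓ : NumberField.RingOfIntegers K) ∈ v.asIdeal), let D := Literature.NumberTheory.PAdicHodge.fontainePstAdicCompletion v ℓ hv; letI := D.algebra; ∃ (τ' : v.adicCompletion K →ₐ[ℚ_[ℓ]] PadicAlgCl ℓ) (a b c : ℤ), a < b ∧ b < c ∧ a ∈ r.labelledHodgeTateWeightsAt v D.algebra D.𝔅 τ'.toRingHom ∧ c ∈ r.labelledHodgeTateWeightsAt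 v D.algebra D.𝔅 τ'.toRingHom ∧ b ∉ r.labelledHodgeTateWeightsAt v D.algebra D.𝔅 τ'.toRingHom) → r.IsResidualRepOf (RingHom.id _) τ → Literature.NumberTheory.GaloisRepresentations.IsAbsIrreducible τ → Literature.NumberTheory.GaloisRepresentations.IsDecomposedGeneric τ → let H := Literature.NumberTheory.GaloisRepresentations.absGaloisGroupAdjoinRootsOfUnity K ℓ; Literature.NumberTheory.GaloisRepresentations.IsAbsIrreducible (τ.comp H.subtype) → Literature.NumberTheory.GaloisRepresentations.Subgroup.IsEnormous (H.map τ) → (∃ σ : Field.absoluteGaloisGroup K, σ ∉ H ∧ ∃ c : k, (τ σ).1 = c • 1) → ∃ (hcpt : _) (Pi : Literature.NumberTheory.Automorphic.CuspidalAutomorphicRepData n K hcpt), Pi.1.IsRegularAlgebraic ∧ (∀ q : ℕ, q.Prime → q ≠ ℓ → (∀ w : IsDedekindDomain.HeightOneSpectrum (NumberField.RingOfIntegers K), (q : NumberField.RingOfIntegers K) ∈ w.asIdeal → Pi.1.IsUnramifiedAt w) → ∀ v : IsDedekindDomain.HeightOneSpectrum (NumberField.RingOfIntegers K), (q : NumberField.RingOfIntegers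 K) ∈ v.asIdeal → ∀ α : Multiset ℂ, Pi.1.HasSatakeParamAt v α → r.IsUnramifiedAt v ∧ r.HasFrobCharpolyAt v (Literature.NumberTheory.Automorphic.arithFrobPolyOfSatake ι v.residueCard n α)) ∧ ∀ w : IsDedekindDomain.HeightOneSpectrum (NumberField.RingOfIntegers K), (ℓ : NumberField.RingOfIntegers K) ∈ w.asIdeal → Pi.1.IsUnramifiedAt w

/-- The insoluble-descent seam D: under X's cell hypotheses, potential automorphy over CM
Galois `K'/K` avoiding every prescribed finite `Kav/K` (X's conclusion, for all `Kav`) implies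
actual automorphy over `K`. Open (SolvableImageBarrier (b)); typed here, not claimed. -/
def InsolubleDescentCell : Prop :=
  ∀ (K : Type) [Field K] [NumberField K], NumberField.IsCMField K → ∀ (n B : ℕ), 2 ≤ n → ∀ (ℓ : ℕ) [Fact ℓ.Prime], n ^ 2 < ℓ → 2 * B + 2 < ℓ → Algebra.IsUnramifiedIn (NumberField.RingOfIntegers K) (Ideal.span {(ℓ : ℤ)}) → let k := Literature.NumberTheory.GaloisRepresentations.padicAlgClResidueField ℓ; ∀ (ι : PadicAlgCl ℓ ≃+* ℂ) (r : Literature.NumberTheory.GaloisRepresentations.FramedGaloisRep K (PadicAlgCl ℓ) n) (τ : Field.absoluteGaloisGroup K →* GL (Fin n) k), (∀ᶠ v in cofinite, r.IsUnramifiedAt v) → (∀ (v : IsDedekindDomain.HeightOneSpectrum (NumberField.RingOfIntegers K)) (hv : (ℓ : NumberField.RingOfIntegers K) ∈ v.asIdeal), let D := Literature.NumberTheory.PAdicHodge.fontainePstAdicCompletion v ℓ hv; D.IsCrystallineFramed (r.toLocal v) ∧ (letI := D.algebra; ∀ τ' : v.adicCompletion K →ₐ[ℚ_[ℓ]] PadicAlgCl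 ℓ, (r.labelledHodgeTateWeightsAt v D.algebra D.𝔅 τ'.toRingHom).Nodup ∧ ∀ h ∈ r.labelledHodgeTateWeightsAt v D.algebra D.𝔅 τ'.toRingHom, 0 ≤ h ∧ h ≤ (B : ℤ))) → (∃ (v : IsDedekindDomain.HeightOneSpectrum (NumberField.RingOfIntegers K)) (hv : (ℓ : NumberField.RingOfIntegers K) ∈ v.asIdeal), let D := Literature.NumberTheory.PAdicHodge.fontainePstAdicCompletion v ℓ hv; letI := D.algebra; ∃ (τ' : v.adicCompletion K →ₐ[ℚ_[ℓ]] PadicAlgCl ℓ) (a b c : ℤ), a < b ∧ b < c ∧ a ∈ r.labelledHodgeTateWeightsAt v D.algebra D.𝔅 τ'.toRingHom ∧ c ∈ r.labelledHodgeTateWeightsAt v D.algebra D.𝔅 τ'.toRingHom ∧ b ∉ r.labelledHodgeTateWeightsAt v D.algebra D.𝔅 τ'.toRingHom) → r.IsResidualRepOf (RingHom.id _) τ → Literature.NumberTheory.GaloisRepresentations.IsAbsIrreducible τ → Literature.NumberTheory.GaloisRepresentations.IsDecomposedGeneric τ → let H := Literature.NumberTheory.GaloisRepresentations.absGaloisGroupAdjoinRootsOfUnity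 K ℓ; Literature.NumberTheory.GaloisRepresentations.IsAbsIrreducible (τ.comp H.subtype) → Literature.NumberTheory.GaloisRepresentations.Subgroup.IsEnormous (H.map τ) → (∃ σ : Field.absoluteGaloisGroup K, σ ∉ H ∧ ∃ c : k, (τ σ).1 = c • 1) → (∀ (Kav : Type) [Field Kav] [Algebra K Kav], FiniteDimensional K Kav → ∃ (K' : Type) (_ : Field K') (_ : NumberField K') (_ : Algebra K K'), IsGalois K K' ∧ NumberField.IsCMField K' ∧ IsField (TensorProduct K Kav K') ∧ Algebra.IsUnramifiedIn (NumberField.RingOfIntegers K') (Ideal.span {(ℓ : ℤ)}) ∧ ∃ (hcpt' : _) (Pi : Literature.NumberTheory.Automorphic.CuspidalAutomorphicRepData n K' hcpt'), Pi.1.IsRegularAlgebraic ∧ (∀ q : ℕ, q.Prime → q ≠ ℓ → (∀ w : IsDedekindDomain.HeightOneSpectrum (NumberField.RingOfIntegers K'), (q : NumberField.RingOfIntegers K') ∈ w.asIdeal → Pi.1.IsUnramifiedAt w) → ∀ v : IsDedekindDomain.HeightOneSpectrum (NumberField.RingOfIntegers K'), (q : NumberField.RingOfIntegers K') ∈ v.asIdeal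 → ∀ α : Multiset ℂ, Pi.1.HasSatakeParamAt v α → (r.restrictField K').IsUnramifiedAt v ∧ (r.restrictField K').HasFrobCharpolyAt v (Literature.NumberTheory.Automorphic.arithFrobPolyOfSatake ι v.residueCard n α)) ∧ ∀ w : IsDedekindDomain.HeightOneSpectrum (NumberField.RingOfIntegers K'), (ℓ : NumberField.RingOfIntegers K') ∈ w.asIdeal → Pi.1.IsUnramifiedAt w) → ∃ (hcpt : _) (Pi : Literature.NumberTheory.Automorphic.CuspidalAutomorphicRepData n K hcpt), Pi.1.IsRegularAlgebraic ∧ (∀ q : ℕ, q.Prime → q ≠ ℓ → (∀ w : IsDedekindDomain.HeightOneSpectrum (NumberField.RingOfIntegers K), (q : NumberField.RingOfIntegers K) ∈ w.asIdeal → Pi.1.IsUnramifiedAt w) → ∀ v : IsDedekindDomain.HeightOneSpectrum (NumberField.RingOfIntegers K), (q : NumberField.RingOfIntegers K) ∈ v.asIdeal → ∀ α : Multiset ℂ, Pi.1.HasSatakeParamAt v α → r.IsUnramifiedAt v ∧ r.HasFrobCharpolyAt v (Literature.NumberTheory.Automorphic.arithFrobPolyOfSatake ι v.residueCard n α)) ∧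 ∀ w : IsDedekindDomain.HeightOneSpectrum (NumberField.RingOfIntegers K), (ℓ : NumberField.RingOfIntegers K) ∈ w.asIdeal → Pi.1.IsUnramifiedAt w

/-- The seam is exact: X and D give actual automorphy in the cell over the base CM field.
Pure logic (instantiate X at every `Kav`). -/
theorem actualCell_of_X_D (hX : GappedWeightPA) (hD : InsolubleDescentCell) : ActualCellHLTT := by
  intro K _ _ hCM n B hn ℓ _ hnl hBl hunr k ι r τ hae hcr hgap hres hirr hdg H hirrH hen hsc
  exact hD K hCM n B hn ℓ hnl hBl hunr ι r τ hae hcr hgap hres hirr hdg hirrH hen hsc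
    (fun Kav _ _ hfd => hX K hCM Kav hfd n B hn ℓ hnl hBl hunr ι r τ hae hcr hgap hres hirr hdg
      hirrH hen hsc)

/- Kernel facts about the crux itself are already on file in
`Cruxes/SectorComplement/Position_TameTypeSwitch.lean` (by the equivalence auditor):
`Langlands → SectorComplement`, `GappedWeightPA → (SectorComplement ↔ Langlands)`,
`¬ SectorComplement ↔ GappedWeightPA ∧ ¬ Langlands`.  They are not restated here so that no
declaration of this sketch has the crux as its literal conclusion type. -/

end Summit.Langlands.Langlands.Cruxes.SectorComplement.DescentSeamTTS
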